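import Mathlib
import Summits.Ventures.HodgeRepro.Tier4.Target
import Summits.Ventures.HodgeRepro.Tier4.Line3.KMDatum
import Summits.Ventures.HodgeRepro.Tier4.Line3.KMDatumS
import Summits.Ventures.HodgeRepro.Tier4.Line3.Defs

/-!
# Tier4/Line3/Localiser — the deep-level congruence ball and the localiser interfaces of LINE L3, verbatim

Blind re-derivation cell `pub-hodge-repro`, Tier 4 «PROVE THE STEP» (README §9–§10).  Line L3 (planner t4-plan-3):
`Tier4/Line3/Skeleton.lean` v0.14, sha256 5b774b9a8f48f824d10bb62c4e4e18383ea9412af18a51e163cf606befcaa3f5, 1004 lines («LINE L3 FILED» S12401).  Companion of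
`Tier4/Line3/Defs.lean` (filer t4-L3-p2): the three definitions the lead asked to keep in their own small module
(S12401: «`InBall` will change once more in v0.15 — keep it in its own small module so the v0.15 diff is one def») —
`T4Data.InBall` (the depth-`N` congruence ball at `𝔭`), `T4Data.Loc` (the deep-level localiser interface) and
`T4Data.LocE` (the localiser with the Euler-product clause) — BYTE-IDENTICAL to the skeleton, same namespace
`Summit.Ventures.HodgeRepro.Tier4.Line3.T4Data`.

Nothing here says anything about the status of the Hodge conjecture for CM abelian varieties, which is NOT proved
(HC_CM is NOT proved by anyone in this repository).
-/
set_option autoImplicit false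

noncomputable section

namespace Summit.Ventures.HodgeRepro.Tier4.Line3

open Summit.Ventures.HodgeRepro.Tier4
open Matrix MeasureTheory NumberField
open Filter Topology
open scoped ComplexConjugate ComplexOrder

open scoped Classical

section Assembly

variable {Level : Type} {Tr : Level → Type}

namespace OrbitExpansion

variable {Orbit : Type} {pairing : ∀ K : Level, Tr K → ℂ} {term : ∀ K : Level, Tr K → Orbit → ℂ}

namespace Localizer

variable {E : OrbitExpansion Orbit pairing term} (L : E.Localizer)

end Localizer

end OrbitExpansion

end Assembly

namespace T4Data

variable (X : T4Data)

end T4Data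

namespace T4Data

variable (X : T4Data)

/-- `x ≡ xm mod 𝔭^N L` LOCALLY AT `𝔭` (all four vectors; denominators prime to `𝔭` allowed): the depth-`N`
congruence ball around `xm` at the prime `𝔭`. -/
def InBall (p : IsDedekindDomain.HeightOneSpectrum (NumberField.RingOfIntegers X.E)) (N : ℕ)
    (L : Submodule (NumberField.RingOfIntegers X.E) (Fin 3 → X.E)) (xm x : X.Tuple) : Prop :=
  ∀ j, ∃ a : NumberField.RingOfIntegers X.E, a ∉ p.asIdeal ∧ a • (x j - xm j) ∈ p.asIdeal ^ N • L

/-! ### II-c. The identification data (PRINTED INPUT) and the localisers -/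

/-- A **DEEP-LEVEL LOCALISER** around `xm` at the prime `𝔭` (step 3 as DATA with its defining properties): for each
depth `N` a level and a `ℂ`-combination of Hecke quadruples of that level whose quadruple coefficient function is
supported (up to the torus) in the depth-`N` congruence ball around `xm`, equals `1` at `xm`, and grows at most
polynomially in the ball coordinates, uniformly in `N` (the local torus averages of lattice indicators grow like the
content of the vector; the Gaussians of the kernel absorb polynomial growth).  Positivity of the main term is NOT a
field (the per-class coefficients carry the signs of the unramified torus sums); it is the content of L3.6. -/
structure Loc (D : X.ThetaData) (p : IsDedekindDomain.HeightOneSpectrum (NumberField.RingOfIntegers X.E))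
    (L₀ : Submodule (NumberField.RingOfIntegers X.E) (Fin 3 → X.E)) (xm : X.Tuple) where
  /-- the level at depth `N` -/
  level : ℕ → X.Level
  /-- the localising translate at depth `N` -/
  loc : ∀ N : ℕ, X.Tr (level N)
  /-- support in the depth-`N` ball (some representative of the line tuple lies in it) -/
  supp : ∀ N (w : X.LineTuple), X.coefQ D.cf (loc N) (X.rep w) ≠ 0 → ∃ x : X.Tuple, X.lines x = w ∧ X.InBall p N L₀ xm x
  /-- normalisation at `xm` -/
  main_one : ∀ N, X.coefQ D.cf (loc N) xm = 1
  /-- polynomial growth, uniformly in the depth -/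
  growth : ∃ B e : ℝ, ∀ N (w : X.LineTuple),
    ‖X.coefQ D.cf (loc N) (X.rep w)‖ ≤ B * ∏ j, (1 + ‖X.ballCoord (X.rep w j)‖) ^ e
  /-- the level at depth `N` is no deeper than `Γ ∩ Γ(q₀^N)` for ONE `q₀` (v0.12, t4-L2-p3 S12270: without this a
  localiser may re-express the same Hecke combination at an arbitrarily deep auxiliary level — `coefQ` unchanged, every
  other clause inherited — and the orbital terms scale with the index of the level, so no majorant exists); the honest
  `𝔭`-adic localiser has level `Γ ∩ Γ(𝔭^N) ⊇ Γ ∩ Γ(q^N)`, `q = N(𝔭) ∈ 𝔭`, so L3.3 delivers it; under it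
  `[Γ : level N] ≤ |GL_3(𝒪/q₀^N)| ≤ q₀^{9dN}`, which the off-main Gaussian `e^{−c q^{N/d}}` beats -/
  level_le : ∃ q₀ : ℕ, 1 ≤ q₀ ∧ ∀ N, X.Γ ∩ principalCongruence X.c X.H (q₀ ^ N) ⊆ (level N).1

/-- A deep-level localiser WITH THE EULER PRODUCT (the R1 repair of L3.6, lead S12159: a clause on the localiser
describing the values of `coefQ (loc N)` on the main orbit, DELIVERED by L3.3 and CONSUMED by L3.6).  The values
themselves are NOT sign-definite for the genuine localiser (the unramified local torus averages are geometric sums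
`Σ_n μ_v(ϖ)^n`), so the clause is what the Euler product actually delivers: the CLASS SUMS `S_N = classSum (loc N) xm`
(the weighted sum of `coefQ (loc N)` over the `Γ′_N`-classes of the main orbit, II-b′) CONVERGE to a NON-ZERO limit —
`S_N → O_𝔭(loc_N φ_𝔭, xm) · ∏_{v ∉ S} 1 · ∏_{v ∈ S∖𝔭} O_v(φ_v, xm)` by strong approximation and the FACE relation on
`Stab = E′^1 × E′^1`.  A localiser satisfying only `Loc` may have main term `≡ 0` (the critics' `loc′_N = loc_N − c_N γ′_N`,
S12146); this clause is exactly what excludes it. -/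
structure LocE (D : X.ThetaData) (p : IsDedekindDomain.HeightOneSpectrum (NumberField.RingOfIntegers X.E))
    (L₀ : Submodule (NumberField.RingOfIntegers X.E) (Fin 3 → X.E)) (xm : X.Tuple) extends X.Loc D p L₀ xm where
  /-- the class sums of the main orbit converge to a non-zero limit (the Euler product) -/
  euler : ∃ κ : ℂ, κ ≠ 0 ∧ Tendsto (fun N => X.classSum D.cf (loc N) xm) atTop (𝓝 κ)

end T4Data

end Summit.Ventures.HodgeRepro.Tier4.Line3

end
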